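import Literature.AlgebraicGeometry.HodgeTheory.WeilClassesCyclicPrymTyping
import Literature.AlgebraicGeometry.Motives.AbelianVarietyCohomologyExteriorH1
import HarnessLib

/-!
# Typing of the single pull-back `(𝟙 + φ)^*` on `Hᵏ = ⋀ᵏ H¹`, and wedges of isotypic classes

Helper file for line `isotypic-unimodular-saturation`, stub `stub_heckePrymWeilPlane`
(`--supports stmt-HodgeConjecture-1261`).  Two cohomological bricks, both PROVED for every complex
abelian variety (using `H•(A(ℂ); ℂ) = ⋀• H¹`, a THEOREM of the tree:
`Motives.AbelianVariety.hasExteriorCohomologyH1_complexPoints`):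

* `eigenspace_map_id_add_le_span_cupPowOne` — for `φ ≫ φ = -d`, `d ≥ 1`, `μ = ± i√d` and a degree
  `k` in which `1 + μ` SEPARATES (`(1+μ)ᵃ(1-μ)ᵇ ≠ (1+μ)ᵏ` for `a + b = k`, `b ≥ 1`; for `d = 7` and
  every `k` this is `Negative.EigenvalueTyping.mixed_eq_plus_iff` / `…_minus_iff`), the eigenspace
  `Eig((𝟙 + φ)^*|Hᵏ, (1+μ)ᵏ)` is contained in the span of the cup products `v₀ ⌣ ⋯ ⌣ v_{k-1}` of
  classes `vᵢ ∈ V_μ = Eig(φ^*|H¹, μ)` (it is in fact `⋀ᵏ V_μ`; only `≤` is needed downstream).  Proof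
  as in `HodgeTheory.eigenspace_map_nsmul_id_add_nsmul_eq_pullbackEigenclasses` (van Geemen, proof of
  Thm. 6.12): the wedge basis of an eigenbasis of `H¹ = V_μ ⊕ V_{-μ}` diagonalises `(𝟙 + φ)^*` with
  character `∏ (1 + λᵢ)`, which is `(1+μ)ᵏ` only on pure wedges.
* `cupPowOne_mem_eigenspace_two_smul_id_add` — a cup product of `k` classes of the
  `μ`-eigenspace of `s^*` on `H¹` lies in `Eig((2·𝟙 + s)^*|Hᵏ, (2 + μ)ᵏ)` (naturality of `⌣` and
  additivity of pull-back on `H¹`): the easy inclusion `⋀ᵏ H¹(B)_{ζ^a} ⊆ Eig((2·𝟙+s_B)^*, (2+ζ^a)ᵏ)`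
  of the typing of Schoen's lines in `stub_schoenLines`.

No definitions; no named facts.
-/

noncomputable section

set_option linter.dupNamespace false

open CategoryTheory
open Literature.AlgebraicGeometry Literature.AlgebraicGeometry.Motives
  Literature.AlgebraicGeometry.HodgeTheory Literature.AlgebraicTopology.SingularHomology

namespace Summit.HodgeConjecture.HodgeConjecture.Theorems.WeilTwelvefoldsSqrtMinus7.IsotypicUnimodularSaturation

section SingleOperator

variable {A : AbelianVariety ℂ}

/-- **`(𝟙 + φ)^* c = (1 + μ) c` on a `μ`-eigenvector `c` of `φ^*` in `H¹`** (additivity of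
pull-back on `H¹`, `HodgeTheory.complexBetti_map_add_one`). [folklore] -/
theorem complexBetti_map_id_add_one_of_mem_eigenspace {φ : A ⟶ A} {μ : ℂ} {c : complexBetti A.X 1}
    (hc : c ∈ Module.End.eigenspace (complexBetti.map φ.hom.hom.hom 1).hom μ) :
    complexBetti.map (𝟙 A + φ).hom.hom.hom 1 c = (1 + μ) • c := by
  rw [complexBetti_map_add_one]
  change ((complexBetti.map (𝟙 A : A ⟶ A).hom.hom.hom 1 + complexBetti.map φ.hom.hom.hom 1).hom) c = _
  rw [ModuleCat.hom_add, LinearMap.add_apply]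
  change (complexBetti.map (𝟙 A.X) 1).hom c + (complexBetti.map φ.hom.hom.hom 1).hom c = _
  rw [complexBetti.map_id, Module.End.mem_eigenspace_iff.mp hc, add_smul, one_smul]
  rfl

/-- `∏ᵢ (1 + λᵢ)` over a family `λᵢ ∈ {μ, -μ}` is `(1+μ)ᵃ (1-μ)ᵇ`, `a`/`b` the numbers of
`λᵢ = μ` / `λᵢ ≠ μ`. [folklore] -/
theorem prod_one_add_eq_pow_mul_pow {μ : ℂ} {N : ℕ} (lam : Fin N → ℂ)
    (hlam : ∀ i, lam i = μ ∨ lam i = -μ) :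
    (∏ i, (1 + lam i)) =
      (1 + μ) ^ (Finset.univ.filter fun i : Fin N => lam i = μ).card *
        (1 - μ) ^ (Finset.univ.filter fun i : Fin N => ¬ lam i = μ).card := by
  have h := prod_add_mul_eq_pow_mul_pow lam hlam 1 1
  simpa only [one_mul] using h

/-- **The eigenspace of the single pull-back `(𝟙 + φ)^*` on `Hᵏ` for `(1+μ)ᵏ` is spanned by pure
wedges of `μ`-eigenvectors.**  For `φ ≫ φ = -d`, `d ≥ 1`, `μ = ± i√d`, and `k` such that
`(1+μ)ᵃ(1-μ)ᵇ ≠ (1+μ)ᵏ` whenever `a + b = k`, `b ≥ 1`: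
`Eig((𝟙 + φ)^*|Hᵏ(A(ℂ); ℂ), (1+μ)ᵏ) ≤ span {v₀ ⌣ ⋯ ⌣ v_{k-1} : vᵢ ∈ Eig(φ^*|H¹, μ)}` (`= ⋀ᵏ V_μ`
under `Hᵏ = ⋀ᵏ H¹`).  Proof: the wedge basis `b_S` of an eigenbasis of `H¹ = V_μ ⊕ V_{-μ}`
(`isCompl_eigenspace_eigenspace_neg`; `Hᵏ = ⋀ᵏ H¹` by
`AbelianVariety.hasExteriorCohomologyH1_complexPoints`) diagonalises `(𝟙 + φ)^*` with character
`∏_{i∈S}(1 + λᵢ) = (1+μ)ᵃ(1-μ)ᵇ` (`map_cupPowOne`), equal to `(1+μ)ᵏ` only for `b = 0`; an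
eigenvector is a combination of the matching `b_S` (`forall_apply_eq_smul_iff_mem_span_image`).
[cite: vanGeemen1994HodgeAV, proof of Thm. 6.12] -/
theorem eigenspace_map_id_add_le_span_cupPowOne {A : AbelianVariety ℂ} {d : ℕ} (hd : 0 < d)
    {φ : A ⟶ A}
    (hφ : φ ≫ φ = -(d • 𝟙 A)) {μ : ℂ}
    (hμ : μ = Complex.I * (Real.sqrt d : ℂ) ∨ μ = -(Complex.I * (Real.sqrt d : ℂ))) (k : ℕ)
    (hsep : ∀ a b : ℕ, a + b = k → 0 < b → (1 + μ) ^ a * (1 - μ) ^ b ≠ (1 + μ) ^ k) :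
    Module.End.eigenspace (complexBetti.map (𝟙 A + φ).hom.hom.hom k).hom ((1 + μ) ^ k) ≤
      Submodule.span ℂ {c | ∃ v : Fin k → complexBetti A.X 1,
        (∀ i, v i ∈ Module.End.eigenspace (complexBetti.map φ.hom.hom.hom 1).hom μ) ∧
          cupPowOne ℂ (ComplexPoints A.X) k v = c} := by
  classical
  haveI := finite_complexBetti_abelianVariety A 1
  have hΛ : HasExteriorCohomologyH1 ℂ (ComplexPoints A.X) :=
    AbelianVariety.hasExteriorCohomologyH1_complexPoints A
  set T := (complexBetti.map φ.hom.hom.hom 1).hom with hT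
  have hcompl : IsCompl (Module.End.eigenspace T μ) (Module.End.eigenspace T (-μ)) := by
    rcases hμ with rfl | rfl
    · exact isCompl_eigenspace_eigenspace_neg hd hφ
    · rw [neg_neg]; exact (isCompl_eigenspace_eigenspace_neg hd hφ).symm
  -- an eigenbasis of `H¹ = V_μ ⊕ V_{-μ}`, the `μ`-vectors first
  set p := Module.finrank ℂ (Module.End.eigenspace T μ) with hp
  set q := Module.finrank ℂ (Module.End.eigenspace T (-μ)) with hq
  let bp := Module.finBasis ℂ (Module.End.eigenspace T μ)
  let bm := Module.finBasis ℂ (Module.End.eigenspace T (-μ))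
  let b₀ : Module.Basis (Fin p ⊕ Fin q) ℂ (complexBetti A.X 1) :=
    (bp.prod bm).map (Submodule.prodEquivOfIsCompl _ _ hcompl)
  let b : Module.Basis (Fin (p + q)) ℂ (complexBetti A.X 1) := b₀.reindex finSumFinEquiv
  let lam : Fin (p + q) → ℂ := fun i => Sum.elim (fun _ => μ) (fun _ => -μ) (finSumFinEquiv.symm i)
  have hlam : ∀ i, lam i = μ ∨ lam i = -μ := fun i => by
    change Sum.elim (fun _ => μ) (fun _ => -μ) (finSumFinEquiv.symm i) = μ ∨
      Sum.elim (fun _ => μ) (fun _ => -μ) (finSumFinEquiv.symm i) = -μ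
    rcases finSumFinEquiv.symm i with j | j
    · exact Or.inl rfl
    · exact Or.inr rfl
  have hb_mem : ∀ i, b i ∈ Module.End.eigenspace T (lam i) := by
    intro i
    rw [Module.Basis.reindex_apply]
    change b₀ (finSumFinEquiv.symm i) ∈
      Module.End.eigenspace T (Sum.elim (fun _ => μ) (fun _ => -μ) (finSumFinEquiv.symm i))
    rcases finSumFinEquiv.symm i with j | j
    · simp only [Sum.elim_inl, b₀, Module.Basis.map_apply, Module.Basis.prod_apply, Function.comp_apply,
        LinearMap.inl_apply, Submodule.coe_prodEquivOfIsCompl', Submodule.coe_zero, add_zero]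
      exact (bp j).2
    · simp only [Sum.elim_inr, b₀, Module.Basis.map_apply, Module.Basis.prod_apply, Function.comp_apply,
        LinearMap.inr_apply, Submodule.coe_prodEquivOfIsCompl', Submodule.coe_zero, zero_add]
      exact (bm j).2
  -- the wedge basis of `Hᵏ` and the action of `(𝟙 + φ)^*` on it
  let Bw : Module.Basis (Set.powersetCard (Fin (p + q)) k) ℂ (complexBetti A.X k) :=
    (b.exteriorPower k).map (hΛ.equiv k)
  have hBw : ∀ S, Bw S = cupPowOne ℂ (ComplexPoints A.X) k
      (b ∘ (Set.powersetCard.ofFinEmbEquiv.symm S)) := by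
    intro S
    change hΛ.equiv k ((b.exteriorPower k) S) = _
    rw [exteriorPower.basis_apply, HasExteriorCohomologyH1.equiv_apply, exteriorPower.ιMulti_family,
      wedgeToCup_ιMulti]
  have hact : ∀ S : Set.powersetCard (Fin (p + q)) k,
      (complexBetti.map (𝟙 A + φ).hom.hom.hom k).hom (Bw S) =
        (∏ i : Fin k, (1 + lam (Set.powersetCard.ofFinEmbEquiv.symm S i))) • Bw S := by
    intro S
    rw [hBw]
    change singularCohomology.map ℂ ℂ
      (AlgPoints.mapContinuous (L := ℂ) (𝟙 A + φ).hom.hom.hom) k (cupPowOne ℂ _ k _) = _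
    rw [map_cupPowOne]
    have e : (fun i => singularCohomology.map ℂ ℂ
        (AlgPoints.mapContinuous (L := ℂ) (𝟙 A + φ).hom.hom.hom) 1
          ((b ∘ (Set.powersetCard.ofFinEmbEquiv.symm S)) i)) =
        fun i => (1 + lam (Set.powersetCard.ofFinEmbEquiv.symm S i)) •
          (b ∘ (Set.powersetCard.ofFinEmbEquiv.symm S)) i := by
      funext i
      exact complexBetti_map_id_add_one_of_mem_eigenspace (hb_mem _)
    rw [e, MultilinearMap.map_smul_univ]
  -- the "good" indices: all `k` eigenvalues equal to `μ`
  let good : Set (Set.powersetCard (Fin (p + q)) k) :=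
    {S | ∀ i : Fin k, lam (Set.powersetCard.ofFinEmbEquiv.symm S i) = μ}
  have hχ : ∀ S : Set.powersetCard (Fin (p + q)) k,
      (∏ i : Fin k, (1 + lam (Set.powersetCard.ofFinEmbEquiv.symm S i))) = (1 + μ) ^ k →
        S ∈ good := by
    intro S hS
    by_contra hne
    obtain ⟨i₀, hi₀⟩ : ∃ i, lam (Set.powersetCard.ofFinEmbEquiv.symm S i) ≠ μ := by
      by_contra! hall
      exact hne hall
    rw [prod_one_add_eq_pow_mul_pow (fun i => lam (Set.powersetCard.ofFinEmbEquiv.symm S i))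
      (fun i => hlam _)] at hS
    refine hsep _ _ (card_filter_add_card_filter_not_eq
      (fun i => lam (Set.powersetCard.ofFinEmbEquiv.symm S i))) (Finset.card_pos.mpr ⟨i₀, ?_⟩) hS
    rw [Finset.mem_filter]
    exact ⟨Finset.mem_univ _, hi₀⟩
  -- an eigenvector is a combination of the good wedge-basis vectors
  intro c hc
  rw [Module.End.mem_eigenspace_iff] at hc
  have h1 := (forall_apply_eq_smul_iff_mem_span_image (P := Unit) Bw
    (fun _ => (complexBetti.map (𝟙 A + φ).hom.hom.hom k).hom)
    (fun S _ => ∏ i : Fin k, (1 + lam (Set.powersetCard.ofFinEmbEquiv.symm S i)))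
    (fun _ S => hact S) (fun _ => (1 + μ) ^ k) c).1 (fun _ => hc)
  refine Submodule.span_mono ?_ h1
  rintro _ ⟨S, hS, rfl⟩
  have hS' : S ∈ good := hχ S (congrFun hS ())
  refine ⟨b ∘ (Set.powersetCard.ofFinEmbEquiv.symm S), fun i => ?_, (hBw S).symm⟩
  have hi := hb_mem (Set.powersetCard.ofFinEmbEquiv.symm S i)
  rw [hS' i] at hi
  exact hi

end SingleOperator

section Isotypic

variable {B : AbelianVariety ℂ}

/-- **`(2·𝟙 + s)^* c = (2 + μ) c` on a `μ`-eigenvector `c` of `s^*` in `H¹`** (additivity of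
pull-back on `H¹`: `complexBetti_map_add_one`, `complexBetti_map_zsmul_one`). [folklore] -/
theorem complexBetti_map_two_smul_id_add_one_of_mem_eigenspace {s : B ⟶ B} {μ : ℂ}
    {c : complexBetti B.X 1}
    (hc : c ∈ Module.End.eigenspace (complexBetti.map s.hom.hom.hom 1).hom μ) :
    complexBetti.map ((2 : ℤ) • 𝟙 B + s).hom.hom.hom 1 c = (2 + μ) • c := by
  rw [complexBetti_map_add_one, complexBetti_map_zsmul_one]
  change (((2 : ℤ) • complexBetti.map (𝟙 B : B ⟶ B).hom.hom.hom 1 +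
    complexBetti.map s.hom.hom.hom 1).hom) c = _
  rw [ModuleCat.hom_add, ModuleCat.hom_zsmul, LinearMap.add_apply, LinearMap.smul_apply]
  change (2 : ℤ) • (complexBetti.map (𝟙 B.X) 1).hom c + (complexBetti.map s.hom.hom.hom 1).hom c = _
  rw [complexBetti.map_id, Module.End.mem_eigenspace_iff.mp hc, add_smul, ← Int.cast_smul_eq_zsmul ℂ]
  push_cast
  rfl

/-- **A cup product of `k` classes of the `μ`-eigenspace of `s^*` on `H¹` lies in
`Eig((2·𝟙 + s)^*|Hᵏ, (2 + μ)ᵏ)`** (naturality of the cup product, `map_cupPowOne`, and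
multilinearity): the inclusion `⋀ᵏ H¹(B)_{ζ^a} ⊆ Eig((2·𝟙_B + s_B)^*, (2 + ζ^a)ᵏ)` of the typing of
Schoen's isotypic lines. [folklore] -/
theorem cupPowOne_mem_eigenspace_two_smul_id_add (s : B ⟶ B) {μ : ℂ} (k : ℕ)
    (w : Fin k → complexBetti B.X 1)
    (hw : ∀ i, w i ∈ Module.End.eigenspace (complexBetti.map s.hom.hom.hom 1).hom μ) :
    cupPowOne ℂ (ComplexPoints B.X) k w ∈
      Module.End.eigenspace (complexBetti.map ((2 : ℤ) • 𝟙 B + s).hom.hom.hom k).hom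
        ((2 + μ) ^ k) := by
  rw [Module.End.mem_eigenspace_iff]
  change singularCohomology.map ℂ ℂ
    (AlgPoints.mapContinuous (L := ℂ) ((2 : ℤ) • 𝟙 B + s).hom.hom.hom) k (cupPowOne ℂ _ k w) = _
  rw [map_cupPowOne]
  have e : (fun i => singularCohomology.map ℂ ℂ
      (AlgPoints.mapContinuous (L := ℂ) ((2 : ℤ) • 𝟙 B + s).hom.hom.hom) 1 (w i)) =
      fun i => (2 + μ) • w i := by
    funext i
    exact complexBetti_map_two_smul_id_add_one_of_mem_eigenspace (hw i)
  rw [e, MultilinearMap.map_smul_univ, Finset.prod_const, Finset.card_univ, Fintype.card_fin]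

/-- **Pull-back of cup products of degree-one classes**: `j^*(w₀ ⌣ ⋯ ⌣ w_{k-1}) =
j^*w₀ ⌣ ⋯ ⌣ j^*w_{k-1}` for a homomorphism `j` of abelian varieties (naturality, element form of
`Motives.complexBetti_map_cupPowOne`). [cite: HatcherAT2002, §3.2 Prop. 3.10] -/
theorem complexBetti_map_cupPowOne_hom {P : AbelianVariety ℂ} (j : P ⟶ B) (k : ℕ)
    (w : Fin k → complexBetti B.X 1) :
    complexBetti.map j.hom.hom.hom k (cupPowOne ℂ (ComplexPoints B.X) k w) =
      cupPowOne ℂ (ComplexPoints P.X) k (fun i => (complexBetti.map j.hom.hom.hom 1).hom (w i)) :=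
  complexBetti_map_cupPowOne _ k w

end Isotypic

end Summit.HodgeConjecture.HodgeConjecture.Theorems.WeilTwelvefoldsSqrtMinus7.IsotypicUnimodularSaturation

end
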